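import Literature.NumberTheory.EllipticCurves.KrizLi2019.SexticTwistBSDThreeDescent
import HarnessLib

/-!
# `ord_p #E(K)_tors = ord_p #E(ℚ)_tors + ord_p #E^{(d)}(ℚ)_tors` for a quadratic field `K = ℚ(√d)` and odd `p`, in ANY rank (cell `b2b-bsdres`, sub-cell additive-p1, gen 13)

HONEST FRAMING (cell `b2b-bsdres`, run/shared/lean/b2b/bsd-rank1-residual/, verbatim in every
file): the goal of the cell is to DELETE the COMBINATION-SHAPED residual classes of the
Birch–Swinnerton-Dyer formula for ALL analytic-rank `≤ 1` elliptic curves over `ℚ` — assembled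
STRICTLY from published theorems — so that the rank-`≤ 1` remainder becomes exactly the
CONSTRUCTION-SHAPED classes, which are TYPED, NOT attempted. This is not "finishing BSD".
Sub-cell additive-p1: research route on X3♯(M)/X4(M); labels UNCHANGED; nothing booked.

THEOREMS ONLY. Kriz–Li's tree lemma `padicValNat_torsionOrder_baseChange_quadratic` states the
torsion bookkeeping `v_p(#E(K)_tors) = v_p(#E(ℚ)_tors) + v_p(#E^{(d)}(ℚ))` under the hypothesis
that the twist `E^{(d)}(ℚ)` is FINITE (the rank-one-`E` / rank-zero-twist situation of the cell's
Gross–Zagier bookkeeping). The underlying statement on `p`-primary components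
(`card_primaryComponent_point_baseChange_quadratic_of_odd`) has no rank hypothesis; this file
records the torsion-order form in ANY rank (needed when the rank lives in the twist: the rank-zero
twin of the bookkeeping identity, `RankZeroShaAnIdentity.lean`).

Technical note: the tree's point-group lemmas over a general field `F` carry the classical
`DecidableEq F` inside their statements; specialised to `F = ℚ` they meet Mathlib's
`instDecidableEqRat`. The local instance priority below (this file only; no library instance is
changed) makes the two agree, exactly as in `RankZeroTwistHeights.lean`.
-/

noncomputable section

open scoped Classical

attribute [local instance 2000] Classical.propDecidable

open WeierstrassCurve Literature.NumberTheory.EllipticCurves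
  Literature.NumberTheory.EllipticCurves.KrizLi2019 Literature.NumberTheory.QuadraticFields

namespace Summit.BirchSwinnertonDyer.Rank1Residual.AdditivePotMult

/-- **Torsion under quadratic base change at an odd prime, any rank**: for `E/ℚ`, `K = ℚ(θ)`
quadratic with `θ² = c`, `d = c q²` (`q ≠ 0`), `Wd` any model of `E^{(d)}`, and `p` odd,
`ord_p #E(K)_tors = ord_p #E(ℚ)_tors + ord_p #Wd(ℚ)_tors` (`E(K)[p^∞] ≅ E(ℚ)[p^∞] ⊕ E^{(d)}(ℚ)[p^∞]`,
`p` odd: the tree's `card_primaryComponent_point_baseChange_quadratic_of_odd`, read on the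
torsion subgroups via `natCard_primaryComponent_eq_pow_padicValNat_torsion`). [folklore] -/
theorem padicValNat_torsionOrder_baseChange_quadratic_anyRank
    (W : WeierstrassCurve ℚ) [W.IsElliptic] (K : Type) [Field K] [NumberField K]
    (h2 : Module.finrank ℚ K = 2) {θ : K} {c : ℚ} (hθ : θ ∉ Set.range (algebraMap ℚ K))
    (hc : θ ^ 2 = algebraMap ℚ K c) {d q : ℚ} (hq : q ≠ 0) (hd : d = c * q ^ 2)
    (Wd : WeierstrassCurve ℚ) [Wd.IsElliptic] (hWd : ∃ C : VariableChange ℚ, C • W.quadraticTwist d = Wd)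
    (p : ℕ) [Fact p.Prime] (hp : p ≠ 2) :
    padicValNat p (W.baseChange K).torsionOrder =
      padicValNat p W.torsionOrder + padicValNat p Wd.torsionOrder := by
  haveI : NeZero (2 : ℚ) := ⟨two_ne_zero⟩
  haveI : (W.baseChange K).IsElliptic := isElliptic_baseChange' W K
  haveI : Finite (AddCommGroup.torsion W.toAffine.Point) := W.finite_torsion_holds
  haveI : Finite (AddCommGroup.torsion (W.baseChange K).toAffine.Point) :=
    (W.baseChange K).finite_torsion_holds
  haveI : Finite (AddCommGroup.torsion Wd.toAffine.Point) := Wd.finite_torsion_holds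
  have hcard := card_primaryComponent_point_baseChange_quadratic_of_odd W h2 hθ hc hq hd hWd
    (W' := W.baseChange K) ⟨1, one_smul _ _⟩ p hp
  rw [natCard_primaryComponent_eq_pow_padicValNat_torsion p,
    natCard_primaryComponent_eq_pow_padicValNat_torsion p,
    natCard_primaryComponent_eq_pow_padicValNat_torsion p, ← pow_add] at hcard
  exact Nat.pow_right_injective (Fact.out : p.Prime).two_le hcard

end Summit.BirchSwinnertonDyer.Rank1Residual.AdditivePotMult

end
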